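import Summits.Ventures.PercRepro2.CaseOneJ1
import Summits.Ventures.PercRepro2.CaseOneTwoMarkIClose

/-!
# `(J1)` for the two-mark class (blind cell PercRepro2, p1 g19; CONJECTURES row 2′J1)

`jOneOne_of_twoMark` (CaseOneTwoMarkIClose) has root-symmetric hypotheses, so with its mirror
(`jOne_of_jOneOne_of_mirror`): **`jOne_of_twoMark`** — `(J1)` for `a₃` adjacent exactly to `o` and
`b`, every finite graph, every weight vector. Own code; standard axioms.
-/

namespace Summit.Ventures.PercRepro2

namespace CaseOne

section JOneTwoMark
variable {V : Type*} {E : Type*} [Fintype E] [DecidableEq E] [Fintype V] [DecidableEq V]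
  {R : Type*} [Field R] [LinearOrder R] [IsStrictOrderedRing R]
variable {ends : E → Sym2 V} {o b a₃ : V} {eo eb : E}

/-- **`(J1)` for `a₃` adjacent exactly to `o` and `b`.** -/
theorem jOne_of_twoMark (p : E → R) (hp : IsProbVec p) (h : IsTwoMarkAt ends o b a₃ eo eb)
    {a₁ a₂ : V} (h1 : a₁ ≠ a₃) (h2 : a₂ ≠ a₃) : JOne p ends o a₁ a₂ a₃ b :=
  jOne_of_jOneOne_of_mirror p ends o a₁ a₂ a₃ b (jOneOne_of_twoMark p hp h h1 h2)
    (jOneOne_of_twoMark p hp h h2 h1)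

end JOneTwoMark

end CaseOne

end Summit.Ventures.PercRepro2
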